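import Summits.ABC.IUTFork.LDHSlotResidue
import Summits.ABC.IUTFork.LDHPerPrimeReadingSlotConstant
import HarnessLib

/-!
# The fork at [IUTchIII] Corollary 3.12, L-DH level: at a SPLIT support prime NO depth-uniform computable half exists
# in reading (U) — the split-prime witness next to the slot-constant contrast (VERDICT RISK ¶7 as a kernel theorem)

Record-only file (D-0012) of the abc-iut cell (campaign-S seat abc-iut-S7, gen 4; sequel to abc-iut-S8's
`LDHSlotResidue.lean` / `LDHSlotResidueAllRegime.lean` and abc-iut-w5-d157's `LDHPerPrimeReadingWitness.lean` /
`LDHPerPrimeReadingSlotConstant.lean`); TAKES NO SIDE on [IUTchIII] Cor. 3.12 or [IUTchIV] Thm. 1.10.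
S. Mochizuki, *IUT IV* [Mochizuki2012], proof of Thm. 1.10 Step (v), kurims pp. 27–28 ("we may assume that `i†` is `j`
… after passing to weighted averages, the operation of symmetrizing with respect to the choice of `i† ∈ I` does not
affect the computation of the upper bound"); Dupuy–Hilado, arXiv:2004.13228 [DupuyHilado2025] §3.3, §3.6, §4.7
((Ind1) = permutations of the tensor factors), §4.10–4.12 (`hull(U_Θ)`, (1.1)); the cell's plan/c312/STEPV-IND1-NOTE.md
and VERDICT RISK ¶7 (the (U)-line of crux `ThetaPartII`, stmt-ABC-19678, registered stub `stub_hullRegime`).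

THE QUESTION. The computable half of [IUTchIV] Thm. 1.10 in reading (U) is `I.HullEstimateOf δ`: "the hull of the
UNION of the possible images of the Θ-pilot region has procession-normalised log-volume `≤ −deĝ̲_lgp(P_Θ) + δ`"
(abc-iut-S2's `GenuineLogTheta.lean`), and print's Step (v)–(viii) display asserts it with a `δ = δ(K, 𝕍^dst, l)`
that does NOT depend on the depth of the bad reduction (the orders `ord_v(q_v)`). The tree has both sides of the
slot analysis: `HullEstimateOf δ → slotResidue ≤ δ` for EVERY input (abc-iut-S8, `DHData.slotResidue_le_of_hullEstimateOf`,
via the (Ind1)-slot lower bound `MultiradialRegionSlotBound`) and `HullEstimateOf (slotResidue + δ_K)` for every input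
(`LDHSlotResidueAllRegime`). This file decides, ON THE INPUT TYPE, whether a depth-free `δ` can exist:

* `PilotData.deepSplitAt` / `ThetaVolumeInput.deepSplitAt p l N σ v₀` — SYNTHETIC genuine-typed Θ-volume inputs over
  any number fields `F₀ ⊆ K` and any section `σ`: `j_E := p^{−2lN}`, `𝕍^bad := {v₀}` for ONE chosen place `v₀` of `F₀`
  over `p` (a legitimate shape: [IUTchI] Def. 3.1 (c) lets `𝕍^bad_mod` be any non-empty set of bad places), ideles
  `t_{Θ,j,v₀} := p^{j²N}`, `t_{q,v₀} := p^N` in the GENUINE completion `K_{v̲₀}` and `1` elsewhere (they realise `P_Θ`,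
  `P_q` since `ord_{v₀}(p) = e_{v₀}`). Exhibited for non-vacuity of the input type; NOT claimed to be the Θ-volume input
  of initial Θ-data of an elliptic curve.
* `deepSplitAt_mu_self` / `deepSplitAt_qPilot_of_ne` — its canonical `log(q)`-slot values: `μ(v₀) = N·log p` at `v₀`
  and `μ(w) = 0` at every other place `w` (in particular at a second place `w | p`): the input is NOT slot-constant at
  `p` as soon as `F₀` has two places over `p`.
* `le_slotResidue_deepSplitAt` — its (Ind1) slot residue is at least the pair residue
  `Pr(v₀)·Pr(w)·((ℓ⋆+1)(2ℓ⋆+1)/6)·N·log p` (abc-iut-S8's `slotResidue_ge_pair_closed`), linear in the depth `N`;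
  `neg_ndegLgp_add_pair_le_negLogThetaNonarch_deepSplitAt` — so its DEFINED (U)-number exceeds the bare-region
  volume `−deĝ̲_lgp(P_Θ)` by at least that much.
* **`not_hullEstimateOf_deepSplitAt_of_lt`** / **`exists_deepSplitAt_not_hullEstimateOf`** — THE SPLIT-PRIME WITNESS:
  for every real `δ` there is a depth `N` with `¬ (deepSplitAt p l N σ v₀).HullEstimateOf δ`, whenever `F₀` has a
  place `w ≠ v₀` over `p`. No constant that is uniform in the depth can serve as the computable half in reading (U)
  at a split support prime — as a statement about Θ-volume inputs (pilot valuations + genuine local fields + ideles).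
* **`hullEstimateOf_deepAt_uniform`** — THE SLOT-CONSTANT CONTRAST (assembled from abc-iut-c312-d1's
  `hullEstimateOf_ofInput` and abc-iut-w5-d157's `explicitDeltaAt_le_of_slotConstant` / `deepAt_slotConstant`): for the
  slot-constant synthetic inputs `deepAt p l N σ` (`𝕍^bad :=` ALL places over `p`, same depth) ONE depth-free constant
  `C(p, l, σ)` gives `(deepAt p l N σ).HullEstimateOf C` for EVERY `N` — there the computable half IS a volume
  computation, exactly as print's Step (v) says.
* `hullEstimateOf_depthUniform_dichotomy` — the two facts side by side.

READING (for the planners; nothing asserted about print). In the cell's typing of (Ind1) as all permutations of the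
`j+1` capsule slots (Dupuy–Hilado §4.7; reading (U) of [IUTchIII] Cor. 3.12's `−|log(Θ)|`, ref-b B14 §1), the Step (v)
sentence quoted above is a theorem at slot-constant collections (one place of `F_mod` over each support prime, e.g.
`d_mod = 1`: abc-iut-S3/S7 `LDHGenuinePerImageSlotConstant`, the «d = 1 cut» `vojtaIneq_two_degOne_of_cor312`) and is
NOT a volume-computation lemma at a split support prime: any closer of the (U)-line's open stub `stub_hullRegime`
(`Cor22.HullVolumeAtDatum P l (B_III P l)` off the slot-constant regime) must use arithmetic of the elliptic curve beyond
its pilot valuations and local fields — at an actual point the needed input is the inequality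
`Pr(v)·Pr(w)·((ℓ⋆+1)(2ℓ⋆+1)/6)·(μ(v) − μ(w)) ≤ B_III(P,l)` on DIFFERENCES of normalised local heights of `j(λ)` at places
`v, w` of `F_mod` over one prime (`PointDict.slotResidue_le_of_hullVolumeAtDatum` + `slotResidue_ge_pair_closed`), an
abc-type statement; conversely a kernel refutation of `stub_hullRegime` at an actual admissible point would need such a
difference exceeding `B_III(P,l) ≥ ((l+1)/4)·(20/3)·log(d*_mod·l)·π(d*_mod·l)`, i.e. an abc triple over a quadratic field
of quality `> 12`. The per-image reading (P) (abc-iut-S7 gen 3, `GenuineLogThetaPerImage*`, `LDHGenuinePerImage*`) has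
no slot residue. HONEST SCOPE: theorems about the tree's typed numbers at SYNTHETIC inhabitants of the input type; no
datum of any elliptic curve is constructed; nothing here asserts or denies [IUTchIV] Thm. 1.10 or [IUTchIII] Cor. 3.12
for initial Θ-data; typed ≠ proved; no side taken.
[cite: Mochizuki2012, IUTchIV Thm. 1.10 Step (v) p. 27–28] [cite: DupuyHilado2025, §3.3, §3.6, §4.7, §4.10–4.12]
[claim: Mochizuki2012, status: disputed] for every IUT quotation.
-/

noncomputable section

open Set NumberField IsDedekindDomain Literature.IUT.LogVolume

namespace Summit.ABC.IUTFork

section Witness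

variable (F₀ : Type) [Field F₀] [NumberField F₀] {K : Type} [Field K] [NumberField K] [Algebra F₀ K]

/-- **Synthetic pilot data with ONE deep bad place `v₀` over `p`**: `j_E := (p^{2lN})⁻¹`, `𝕍^bad := {v₀}`, the prime
`l ≥ 5`; so `ord_{v₀}(q_{v₀}) = 2lN·e_{v₀}` and every other place (in particular every other place over `p`) is
OUTSIDE `𝕍^bad`. An inhabitant of c312-3's `PilotData` chosen for its valuations — NOT claimed to come from a specific
elliptic curve ([IUTchI] Def. 3.1 (c): `𝕍^bad_mod` is any non-empty set of places of bad multiplicative reduction).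
[cite: DupuyHilado2025, §3.2–3.3] [cite: Mochizuki2012, IUTchI Def. 3.1 (c) p. 61] -/
def PilotData.deepSplitAt (p : ℕ) [Fact p.Prime] (l : ℕ) (hl : l.Prime) (h5 : 5 ≤ l) (N : ℕ) (hN : 0 < N)
    (v₀ : placesOver F₀ p) : PilotData F₀ where
  jE := ((p : F₀) ^ (2 * l * N))⁻¹
  S := {v₀.1}
  S_nonempty := Finset.singleton_nonempty _
  ord_jE_neg := fun v hv => by
    rw [Finset.mem_singleton] at hv
    subst hv
    rw [ord_inv, ord_pow, Cor22.ord_natCast_eq_ramIdx p v₀.1 v₀.2]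
    have h1 : (0 : ℤ) < ramIdx F₀ v₀.1 := by exact_mod_cast Nat.pos_of_ne_zero (ramIdx_ne_zero F₀ v₀.1)
    have h2 : (0 : ℤ) < (2 * l * N : ℕ) := by exact_mod_cast (by positivity : 0 < 2 * l * N)
    nlinarith
  l := l
  l_prime := hl
  five_le_l := h5

variable {F₀}
variable (p : ℕ) [hp : Fact p.Prime] (l : ℕ) (hl : l.Prime) (h5 : 5 ≤ l) (N : ℕ) (hN : 0 < N)

/-- `ord_{v₀}(q_{v₀}) = 2lN·e_{v₀}` for the split synthetic pilot data. [cite: DupuyHilado2025, §3.3] -/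
theorem PilotData.deepSplitAt_ordq_self (v₀ : placesOver F₀ p) :
    (PilotData.deepSplitAt F₀ p l hl h5 N hN v₀).ordq v₀.1 = 2 * l * N * ramIdx F₀ v₀.1 := by
  show -ord F₀ v₀.1 (((p : F₀) ^ (2 * l * N))⁻¹) = _
  rw [ord_inv, ord_pow, Cor22.ord_natCast_eq_ramIdx p v₀.1 v₀.2]
  push_cast
  ring

/-- The bad set of the split synthetic pilot data is `{v₀}` (definitional). [cite: DupuyHilado2025, §3.2] -/
theorem PilotData.deepSplitAt_S (v₀ : placesOver F₀ p) :
    (PilotData.deepSplitAt F₀ p l hl h5 N hN v₀).S = {v₀.1} := rfl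

open scoped Classical in
/-- **A SYNTHETIC Θ-volume input with ONE deep bad place `v₀ | p`** over any section `σ` of the places of `K / F₀`:
the pilot data `PilotData.deepSplitAt` (`j_E = p^{−2lN}`, `𝕍^bad = {v₀}`) with the ideles `t_{Θ,j,v₀} := p^{j²N}`,
`t_{q,v₀} := p^N` in the GENUINE completion `K_{v̲₀}` (and `1` at every other place) — they realise `P_Θ`, `P_q` because
`ord_{v₀}(p) = e_{v₀}`. An inhabitant of the INPUT TYPE (abc-iut-S2's `ThetaVolumeInput`), exhibited for non-vacuity;
NOT claimed to be the input of a collection of initial Θ-data of [IUTchI] Def. 3.1. [cite: DupuyHilado2025, §3.9] -/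
def ThetaVolumeInput.deepSplitAt (σ : PlaceSection F₀ K) (v₀ : placesOver F₀ p) : ThetaVolumeInput F₀ K where
  X := PilotData.deepSplitAt F₀ p l hl h5 N hN v₀
  σ := σ
  tΘ p' hp' i v := (@LocalFields.primeUnit' F₀ _ _ p' ⟨hp'⟩ (σ.localFieldFamily p' hp') v) ^
    (if v.1 = v₀.1 then ((i : ℕ) + 1) ^ 2 * N else 0)
  tΘ_ord p' hp' i v := by
    haveI : Fact p'.Prime := ⟨hp'⟩
    rw [LocalFields.ordv_primeUnit'_pow, PilotData.thetaPilot_apply']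
    change (((if v.1 = v₀.1 then ((i : ℕ) + 1) ^ 2 * N else 0 : ℕ) : ℝ) * ramIdx F₀ v.1 =
      if v.1 ∈ ({v₀.1} : Finset (HeightOneSpectrum (𝓞 F₀))) then _ else 0)
    simp only [Finset.mem_singleton]
    split_ifs with hv
    · rw [hv, PilotData.deepSplitAt_ordq_self p l hl h5 N hN v₀]
      change _ = (((i : ℕ) + 1 : ℝ) ^ 2) * ((2 * l * N * ramIdx F₀ v₀.1 : ℤ) : ℝ) / (2 * (l : ℕ))
      have hl0 : (l : ℝ) ≠ 0 := by exact_mod_cast hl.ne_zero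
      push_cast
      field_simp
    · simp
  tq p' hp' i v := (@LocalFields.primeUnit' F₀ _ _ p' ⟨hp'⟩ (σ.localFieldFamily p' hp') v) ^
    (if v.1 = v₀.1 then N else 0)
  tq_ord p' hp' i v := by
    haveI : Fact p'.Prime := ⟨hp'⟩
    rw [LocalFields.ordv_primeUnit'_pow, PilotData.qPilot_apply']
    change (((if v.1 = v₀.1 then N else 0 : ℕ) : ℝ) * ramIdx F₀ v.1 =
      if v.1 ∈ ({v₀.1} : Finset (HeightOneSpectrum (𝓞 F₀))) then _ else 0)
    simp only [Finset.mem_singleton]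
    split_ifs with hv
    · rw [hv, PilotData.deepSplitAt_ordq_self p l hl h5 N hN v₀]
      change _ = ((2 * l * N * ramIdx F₀ v₀.1 : ℤ) : ℝ) / (2 * (l : ℕ))
      have hl0 : (l : ℝ) ≠ 0 := by exact_mod_cast hl.ne_zero
      push_cast
      field_simp
    · simp

namespace ThetaVolumeInput

variable (σ : PlaceSection F₀ K) (v₀ : placesOver F₀ p)

/-- The split synthetic input's procession length is `(l−1)/2`, whatever `N`. [cite: DupuyHilado2025, §3.3] -/
theorem deepSplitAt_lstar : (deepSplitAt p l hl h5 N hN σ v₀).X.lstar = (l - 1) / 2 := rfl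

/-- The support primes of the split synthetic input do not depend on the depth `N`: the prime factors of `2·|disc K|`
and `p` (the residue characteristic of `v₀`). [cite: Mochizuki2012, IUTchIV Thm. 1.10 Step (vi) p. 29] -/
theorem deepSplitAt_supportPrimes :
    (deepSplitAt p l hl h5 N hN σ v₀).supportPrimes =
      (2 * (NumberField.discr K).natAbs).primeFactors ∪ ({v₀.1} : Finset _).image (residueChar F₀) :=
  rfl

/-- `p` is a support prime of the split synthetic input (`v₀ ∈ 𝕍^bad` lies over `p`).
[cite: Mochizuki2012, IUTchIV Thm. 1.10 Step (vi) p. 29] -/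
theorem mem_supportPrimes_deepSplitAt : p ∈ (deepSplitAt p l hl h5 N hN σ v₀).supportPrimes := by
  have h := (deepSplitAt p l hl h5 N hN σ v₀).residueChar_mem_supportPrimes (v := v₀.1)
    (show v₀.1 ∈ ({v₀.1} : Finset _) from Finset.mem_singleton_self _)
  rwa [(mem_placesOver_iff_residueChar v₀.1).mp v₀.2] at h

/-- The `q`-pilot coefficient at the deep place: `P_q(v₀) = ord_{v₀}(q)/(2l) = N·e_{v₀}`. [cite: DupuyHilado2025, §3.3] -/
theorem deepSplitAt_qPilot_self :
    (deepSplitAt p l hl h5 N hN σ v₀).X.qPilot v₀.1 = (N : ℝ) * ramIdx F₀ v₀.1 := by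
  rw [PilotData.qPilot_apply']
  rw [if_pos (show v₀.1 ∈ (deepSplitAt p l hl h5 N hN σ v₀).X.S from Finset.mem_singleton_self _)]
  show (((PilotData.deepSplitAt F₀ p l hl h5 N hN v₀).ordq v₀.1 : ℝ)) / (2 * (l : ℕ)) = _
  rw [PilotData.deepSplitAt_ordq_self p l hl h5 N hN v₀]
  have hl0 : (l : ℝ) ≠ 0 := by exact_mod_cast hl.ne_zero
  push_cast
  field_simp

/-- The `q`-pilot coefficient VANISHES at every place other than `v₀` (they are outside `𝕍^bad = {v₀}`) — in particular
at a second place of `F₀` over `p`. [cite: DupuyHilado2025, §3.3] -/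
theorem deepSplitAt_qPilot_of_ne {w : HeightOneSpectrum (𝓞 F₀)} (hw : w ≠ v₀.1) :
    (deepSplitAt p l hl h5 N hN σ v₀).X.qPilot w = 0 := by
  rw [PilotData.qPilot_apply']
  rw [if_neg (show w ∉ (deepSplitAt p l hl h5 N hN σ v₀).X.S from fun h => hw (Finset.mem_singleton.mp h))]

/-- **The canonical `log(q)`-slot value at the deep place is `μ(v₀) = P_q(v₀)·ln N(v₀)/n_{v₀} = N·log p`**
(`ln N(v₀) = f_{v₀}·log p`, `n_{v₀} = e_{v₀} f_{v₀}`). [cite: DupuyHilado2025, §3.3, §3.6] -/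
theorem deepSplitAt_mu_self :
    (deepSplitAt p l hl h5 N hN σ v₀).X.qPilot v₀.1 * logNorm F₀ v₀.1 / (localDegree F₀ v₀.1 : ℝ) =
      (N : ℝ) * Real.log p := by
  rw [deepSplitAt_qPilot_self, logNorm_eq, (mem_placesOver_iff_residueChar v₀.1).mp v₀.2, localDegree]
  have he : (ramIdx F₀ v₀.1 : ℝ) ≠ 0 := by exact_mod_cast ramIdx_ne_zero F₀ v₀.1
  have hf : (resDeg F₀ v₀.1 : ℝ) ≠ 0 := by exact_mod_cast resDeg_ne_zero F₀ v₀.1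
  push_cast
  field_simp

/-- The canonical `log(q)`-slot value VANISHES at every place `w ≠ v₀`: `μ(w) = 0`. [cite: DupuyHilado2025, §3.3, §3.6] -/
theorem deepSplitAt_mu_of_ne {w : HeightOneSpectrum (𝓞 F₀)} (hw : w ≠ v₀.1) :
    (deepSplitAt p l hl h5 N hN σ v₀).X.qPilot w * logNorm F₀ w / (localDegree F₀ w : ℝ) = 0 := by
  rw [deepSplitAt_qPilot_of_ne p l hl h5 N hN σ v₀ hw, zero_mul, zero_div]

/-- The slope of the witness: `A(v₀, w) := Pr(v₀)·Pr(w)·((ℓ⋆+1)(2ℓ⋆+1)/6)·log p > 0` for places `v₀, w` of `F₀`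
(`Pr > 0`, `(ℓ⋆+1)(2ℓ⋆+1)/6 ≥ 5/2`, `log p > 0`). [cite: DupuyHilado2025, §3.6] -/
theorem deepSplitAt_slope_pos (w : placesOver F₀ p) :
    0 < weight F₀ v₀.1 * weight F₀ w.1 *
      ((((deepSplitAt p l hl h5 N hN σ v₀).X.lstar : ℝ) + 1) * (2 * (deepSplitAt p l hl h5 N hN σ v₀).X.lstar + 1) / 6) *
        Real.log p := by
  have hw1 : 0 < weight F₀ v₀.1 := by
    unfold weight
    exact div_pos (by exact_mod_cast localDegree_pos F₀ v₀.1) (by exact_mod_cast Module.finrank_pos)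
  have hw2 : 0 < weight F₀ w.1 := by
    unfold weight
    exact div_pos (by exact_mod_cast localDegree_pos F₀ w.1) (by exact_mod_cast Module.finrank_pos)
  have hlogp : 0 < Real.log p := Real.log_pos (by exact_mod_cast hp.out.one_lt)
  positivity

/-- **The (Ind1) slot residue of the split synthetic input is at least the pair residue
`Pr(v₀)·Pr(w)·((ℓ⋆+1)(2ℓ⋆+1)/6)·N·log p`** for every place `w ≠ v₀` of `F₀` over `p` (abc-iut-S8's
`slotResidue_ge_pair_closed` at the pair `(v₀, w)`: `μ(v₀) − μ(w) = N·log p`) — LINEAR IN THE DEPTH `N`.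
[cite: DupuyHilado2025, §3.6, §4.7] [cite: Mochizuki2012, IUTchIV Thm. 1.10 Step (v) p. 27–28] -/
theorem le_slotResidue_deepSplitAt (w : placesOver F₀ p) (hw : w ≠ v₀) :
    weight F₀ v₀.1 * weight F₀ w.1 *
      ((((deepSplitAt p l hl h5 N hN σ v₀).X.lstar : ℝ) + 1) * (2 * (deepSplitAt p l hl h5 N hN σ v₀).X.lstar + 1) / 6) *
        ((N : ℝ) * Real.log p) ≤
      (deepSplitAt p l hl h5 N hN σ v₀).X.slotResidue (deepSplitAt p l hl h5 N hN σ v₀).supportPrimes := by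
  have hw' : w.1 ≠ v₀.1 := fun h => hw (Subtype.ext h)
  have h := (deepSplitAt p l hl h5 N hN σ v₀).X.slotResidue_ge_pair_closed
    (deepSplitAt p l hl h5 N hN σ v₀).supportPrimes (mem_supportPrimes_deepSplitAt p l hl h5 N hN σ v₀) v₀ w
  rw [deepSplitAt_mu_self, deepSplitAt_mu_of_ne p l hl h5 N hN σ v₀ hw', sub_zero] at h
  exact h

/-- **The DEFINED (U)-number of the split synthetic input exceeds the bare-region volume by at least the pair residue**:
`−deĝ̲_lgp(P_Θ) + Pr(v₀)·Pr(w)·((ℓ⋆+1)(2ℓ⋆+1)/6)·N·log p ≤ negLogThetaNonarch` (the hull of the union over the slot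
permutations contains, at every mixed collection through `v₀` and `w`, the region with the Θ-weight moved to the slot
of `w`; abc-iut-S8's `neg_ndegLgp_add_slotResidue_le_negLogThetaNonarch`). [cite: DupuyHilado2025, §4.7, §4.10–4.12] -/
theorem neg_ndegLgp_add_pair_le_negLogThetaNonarch_deepSplitAt (w : placesOver F₀ p) (hw : w ≠ v₀) :
    -LgpDivisor.ndegLgp (deepSplitAt p l hl h5 N hN σ v₀).X.thetaPilot +
        weight F₀ v₀.1 * weight F₀ w.1 *
          ((((deepSplitAt p l hl h5 N hN σ v₀).X.lstar : ℝ) + 1) *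
              (2 * (deepSplitAt p l hl h5 N hN σ v₀).X.lstar + 1) / 6) *
            ((N : ℝ) * Real.log p) ≤
      (deepSplitAt p l hl h5 N hN σ v₀).negLogThetaNonarch := by
  have h1 := DHData.neg_ndegLgp_add_slotResidue_le_negLogThetaNonarch (deepSplitAt p l hl h5 N hN σ v₀)
  have h2 := le_slotResidue_deepSplitAt p l hl h5 N hN σ v₀ w hw
  linarith

/-- **Every computable half for the split synthetic input pays the pair residue**: `HullEstimateOf δ` forces
`Pr(v₀)·Pr(w)·((ℓ⋆+1)(2ℓ⋆+1)/6)·N·log p ≤ δ` (abc-iut-S8's `pair_le_of_hullEstimateOf` at `(v₀, w)`).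
[cite: Mochizuki2012, IUTchIV Thm. 1.10 Step (v) p. 27–28] [cite: DupuyHilado2025, §4.7, §4.12] -/
theorem pair_le_of_hullEstimateOf_deepSplitAt (w : placesOver F₀ p) (hw : w ≠ v₀) {δ : ℝ}
    (h : (deepSplitAt p l hl h5 N hN σ v₀).HullEstimateOf δ) :
    weight F₀ v₀.1 * weight F₀ w.1 *
      ((((deepSplitAt p l hl h5 N hN σ v₀).X.lstar : ℝ) + 1) * (2 * (deepSplitAt p l hl h5 N hN σ v₀).X.lstar + 1) / 6) *
        ((N : ℝ) * Real.log p) ≤ δ :=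
  (le_slotResidue_deepSplitAt p l hl h5 N hN σ v₀ w hw).trans
    (DHData.slotResidue_le_of_hullEstimateOf (deepSplitAt p l hl h5 N hN σ v₀) h)

/-- **THE SPLIT-PRIME WITNESS, quantitative form**: if `δ < Pr(v₀)·Pr(w)·((ℓ⋆+1)(2ℓ⋆+1)/6)·N·log p` for some place
`w ≠ v₀` of `F₀` over `p`, then `¬ (deepSplitAt p l N σ v₀).HullEstimateOf δ` — the hull of the union of the possible
images is too large for the constant `δ`. [cite: Mochizuki2012, IUTchIV Thm. 1.10 Step (v) p. 27–28]
[cite: DupuyHilado2025, §4.7, §4.10–4.12] [claim: Mochizuki2012, status: disputed] -/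
theorem not_hullEstimateOf_deepSplitAt_of_lt (w : placesOver F₀ p) (hw : w ≠ v₀) {δ : ℝ}
    (hδ : δ < weight F₀ v₀.1 * weight F₀ w.1 *
      ((((deepSplitAt p l hl h5 N hN σ v₀).X.lstar : ℝ) + 1) * (2 * (deepSplitAt p l hl h5 N hN σ v₀).X.lstar + 1) / 6) *
        ((N : ℝ) * Real.log p)) :
    ¬ (deepSplitAt p l hl h5 N hN σ v₀).HullEstimateOf δ :=
  fun h => absurd (pair_le_of_hullEstimateOf_deepSplitAt p l hl h5 N hN σ v₀ w hw h) (not_le.mpr hδ)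

/-- **THE SPLIT-PRIME WITNESS — NO DEPTH-UNIFORM COMPUTABLE HALF IN READING (U) AT A SPLIT SUPPORT PRIME.** For every
number fields `F₀ ⊆ K`, every section `σ`, every prime `p` under two DISTINCT places `v₀ ≠ w` of `F₀`, every prime
`l ≥ 5` and every real `δ` there is a depth `N` such that the synthetic genuine-typed input `deepSplitAt p l N σ v₀`
(`j_E = p^{−2lN}`, `𝕍^bad = {v₀}`) violates `HullEstimateOf δ`: the hull of the union of its possible Θ-pilot images
(Mochizuki's container, full (Ind1)/(Ind2), sharp (Ind3), genuine completions `K_{v̲}`) has log-volume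
`> −deĝ̲_lgp(P_Θ) + δ`. Contrast `hullEstimateOf_deepAt_uniform` (slot-constant inputs: one depth-free constant for all
`N`). A statement about the INPUT TYPE; it does not construct Θ-data of any elliptic curve, and takes no side on
[IUTchIV] Thm. 1.10 / [IUTchIII] Cor. 3.12 for initial Θ-data. [cite: Mochizuki2012, IUTchIV Thm. 1.10 Step (v) p. 27–28]
[cite: DupuyHilado2025, §4.7, §4.10–4.12] [claim: Mochizuki2012, status: disputed] -/
theorem exists_deepSplitAt_not_hullEstimateOf (w : placesOver F₀ p) (hw : w ≠ v₀) (δ : ℝ) :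
    ∃ (N : ℕ) (hN : 0 < N), ¬ (deepSplitAt p l hl h5 N hN σ v₀).HullEstimateOf δ := by
  -- the slope `A = Pr(v₀)·Pr(w)·c_L·log p` does not depend on `N` (`ℓ⋆ = (l−1)/2` for every depth)
  set L : ℕ := (l - 1) / 2 with hL
  set A : ℝ := weight F₀ v₀.1 * weight F₀ w.1 * ((((L : ℝ)) + 1) * (2 * L + 1) / 6) * Real.log p with hA
  have hApos : 0 < A := by
    have h := deepSplitAt_slope_pos p l hl h5 1 Nat.one_pos σ v₀ w
    rwa [deepSplitAt_lstar p l hl h5 1 Nat.one_pos σ v₀] at h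
  obtain ⟨N, hNgt⟩ := exists_nat_gt (δ / A)
  refine ⟨N + 1, Nat.succ_pos N, not_hullEstimateOf_deepSplitAt_of_lt p l hl h5 (N + 1) (Nat.succ_pos N) σ v₀ w hw ?_⟩
  rw [deepSplitAt_lstar p l hl h5 (N + 1) (Nat.succ_pos N) σ v₀]
  have h1 : δ < A * N := ((div_lt_iff₀ hApos).mp hNgt).trans_eq (mul_comm _ _)
  have h2 : A * N ≤ A * ((N + 1 : ℕ) : ℝ) :=
    mul_le_mul_of_nonneg_left (by push_cast; linarith) hApos.le
  calc δ < A * ((N + 1 : ℕ) : ℝ) := h1.trans_le h2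
    _ = weight F₀ v₀.1 * weight F₀ w.1 * (((L : ℝ) + 1) * (2 * L + 1) / 6) * ((((N + 1 : ℕ) : ℝ)) * Real.log p) := by
        rw [hA]; ring

/-! ## The slot-constant contrast: ONE depth-free constant serves every `deepAt p l N σ` -/

/-- **THE SLOT-CONSTANT CONTRAST — a depth-UNIFORM computable half EXISTS for the slot-constant synthetic inputs.**
For abc-iut-w5-d157's `deepAt p l N σ` (`j_E = p^{−2lN}`, `𝕍^bad :=` ALL places of `F₀` over `p`, hence slot-constant at
every prime: `deepAt_slotConstant`) the constant `C := Σ_{p' ∈ 𝕍^dst} boundAt'(deepAt p l 1 σ) p'` — a function of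
`p`, `l`, the support primes `𝕍^dst = primeFactors(2·|disc K|) ∪ {p}` and the different / ramification exponents of the
genuine completions of `σ`, NOT of `N` — satisfies `(deepAt p l N σ).HullEstimateOf C` for EVERY depth `N`
(abc-iut-c312-d1's `hullEstimateOf_ofInput` = `HullEstimateOf (explicitDelta)`, `explicitDelta = Σ_{p'} δ_{p'}`, and
`δ_{p'} ≤ boundAt'` at slot-constant primes, `explicitDeltaAt_le_of_slotConstant`). This is print's Step (v) sentence
"the operation of symmetrizing with respect to the choice of `i† ∈ I` does not affect the computation of the upper
bound" AS A THEOREM on the slot-constant regime. [cite: Mochizuki2012, IUTchIV Thm. 1.10 Step (v) p. 27–28]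
[cite: DupuyHilado2025, §3.6, §4.12] -/
theorem hullEstimateOf_deepAt_uniform :
    (deepAt p l hl h5 N hN σ).HullEstimateOf
      (∑ p' ∈ (deepAt p l hl h5 1 Nat.one_pos σ).supportPrimes, boundAt' (deepAt p l hl h5 1 Nat.one_pos σ) p') := by
  set I := deepAt p l hl h5 N hN σ with hI
  have hT : (deepAt p l hl h5 1 Nat.one_pos σ).supportPrimes = I.supportPrimes := rfl
  have hB : ∀ p', boundAt' (deepAt p l hl h5 1 Nat.one_pos σ) p' = boundAt' I p' := fun p' =>
    (boundAt'_deepAt_eq p l hl h5 N hN σ 1 Nat.one_pos p').symm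
  rw [hT]
  simp_rw [hB]
  have hle : DHData.explicitDelta I ≤ ∑ p' ∈ I.supportPrimes, boundAt' I p' := by
    rw [DHData.explicitDelta_eq_sum_explicitDeltaAt]
    refine Finset.sum_le_sum fun p' hp' => ?_
    have hp'P : p'.Prime := I.prime_of_mem_supportPrimes hp'
    haveI : Fact p'.Prime := ⟨hp'P⟩
    rw [boundAt', dif_pos hp'P]
    exact DHData.explicitDeltaAt_le_of_slotConstant I (deepAt_slotConstant p l hl h5 N hN σ p')
  have h0 := DHData.hullEstimateOf_ofInput I
  unfold ThetaVolumeInput.HullEstimateOf at h0 ⊢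
  linarith

/-- **THE DICHOTOMY ON THE INPUT TYPE (VERDICT RISK ¶7 in kernel form).** Over any number fields `F₀ ⊆ K`, section `σ`,
prime `p`, prime `l ≥ 5`: (a) for the SLOT-CONSTANT synthetic family `deepAt p l N σ` there is ONE real `C` with
`HullEstimateOf C` at every depth `N`; (b) for the SPLIT synthetic family `deepSplitAt p l N σ v₀` — available as soon
as `F₀` has two places `v₀ ≠ w` over `p` — NO real `C` serves every depth: for each `C` some depth violates
`HullEstimateOf C`. In reading (U) ((Ind1) = all slot permutations) the computable half of [IUTchIV] Thm. 1.10 is a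
volume computation exactly on the slot-constant regime. Nothing here constructs or constrains the Θ-data of an
elliptic curve; no side taken. [cite: Mochizuki2012, IUTchIV Thm. 1.10 Step (v) p. 27–28]
[cite: DupuyHilado2025, §4.7, §4.10–4.12] [claim: Mochizuki2012, status: disputed] -/
theorem hullEstimateOf_depthUniform_dichotomy (w : placesOver F₀ p) (hw : w ≠ v₀) :
    (∃ C : ℝ, ∀ (N : ℕ) (hN : 0 < N), (deepAt p l hl h5 N hN σ).HullEstimateOf C) ∧
      (∀ C : ℝ, ∃ (N : ℕ) (hN : 0 < N), ¬ (deepSplitAt p l hl h5 N hN σ v₀).HullEstimateOf C) :=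
  ⟨⟨_, fun N hN => hullEstimateOf_deepAt_uniform p l hl h5 N hN σ⟩,
    fun C => exists_deepSplitAt_not_hullEstimateOf p l hl h5 σ v₀ w hw C⟩

end ThetaVolumeInput

end Witness

end Summit.ABC.IUTFork

end
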